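import Literature.AlgebraicGeometry.Limits.FiniteTypeModel
import Literature.AlgebraicGeometry.Limits.ClosedSubschemes
import Literature.AlgebraicGeometry.Limits.SubalgebraDiagram
import Literature.AlgebraicGeometry.Resolution.ChowLemmaProofs
import Summits.ResolutionOfSingularities.ResolutionOfSingularities.Theorems.DescentDescentPerfectToAllRobustModel
import Summits.ResolutionOfSingularities.ResolutionOfSingularities.Theorems.DescentDescentPerfectToAllPropagation
import Mathlib.AlgebraicGeometry.Morphisms.ClosedImmersion
import Mathlib.CategoryTheory.Limits.Shapes.Pullback.Pasting
import Mathlib.Algebra.Algebra.ZMod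
import Mathlib.Algebra.CharP.Algebra
import Mathlib.FieldTheory.Perfect
import Mathlib.FieldTheory.Finite.Basic
import Mathlib.RingTheory.Localization.FractionRing

/-!
# `Descent.DescentPerfectToAll`, line `arc-special-fibre-transversality`: finitely generated levels

Route `ResolutionOfSingularities/Descent`, crux `DescentPerfectToAll`
(stmt-ResolutionOfSingularities-0549), stub `stub_levelResolution` of the lead's skeleton
`work/DescentPerfectToAll.lean`, PROVED here (statement verbatim from the ledger registration).

**Statement (resolution over perfect fields ⇒ resolution over finitely generated fields).** Fix a
prime `p` and assume that every reduced separated scheme of finite type over a PERFECT field of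
characteristic `p` admits a resolution of singularities. Let `k` be a field of characteristic `p`,
`L = closure t ⊆ k` the subfield generated by a finite set `t`, and `g : Z → Spec L` separated,
locally of finite type and quasi-compact with `Z` reduced. Then `Z` admits a resolution.

**Proof.**
1. *Spreading out* (as in `stub_fgModel`): `Literature.AlgebraicGeometry.Limits.exists_finiteTypeModel`
   gives a closed `L`-immersion `j : Z ↪ Y₀ ×_{A₀} Spec L`, `A₀ ⊆ L` finitely generated over `ℤ`,
   `Y₀ → Spec A₀` separated of finite type; writing `Y₀ ×_{A₀} Spec L = lim_{t'} Y₀ ×_{A₀} Spec A₀[t']`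
   over the finite subsets `t' ⊇ t` of `L` (`SubalgApprox.isLimitProdCone`), the closed subscheme
   `Z` is the base change of its scheme-theoretic image `Z_R ↪ Y₀ ×_{A₀} Spec R`, `R = A₀[t']`, for
   some `t'` (`exists_isPullback_toImage_of_isLocallyNoetherian`): `Z ≅ Z_R ×_R Spec L`.
2. `Z_R` is reduced (scheme-theoretic image of the reduced `Z` under a quasi-compact morphism,
   `ChowLemmaProof.isReduced_image`),
   and `Z_R → Spec R → Spec 𝔽_p` is separated of finite type (`R` is finitely generated over `ℤ`,
   hence over `𝔽_p = ZMod p`, a perfect field); the hypothesis yields a resolution `π : Y → Z_R`.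
3. `L = Frac R`: `R ⊆ L` is a domain containing `t`, and `L = closure t` consists of quotients of
   elements of `ℤ[t] ⊆ R` (`Subfield.mem_closure_iff`). Hence `Spec L → Spec R` is flat
   (a localisation) and a preimmersion.
4. The base change `π_L : Y ×_R L → Z_R ×_R L ≅ Z` of `π` is proper (base change), birational
   (`isBirational_of_isPullback_of_flat`: flat base change between Noetherian schemes) and its
   source is regular (`isRegular_of_flat_of_surjectiveOnStalks`: the local rings of `Y ×_R L` are
   local rings of the regular `Y`). Transport along `Z ≅ Z_R ×_R Spec L`
   (`Scheme.HasResolution.of_iso`).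
-/

noncomputable section

set_option linter.dupNamespace false -- mandated namespace of this single-conjunct summit

namespace Summit.ResolutionOfSingularities.ResolutionOfSingularities.Theorems

open CategoryTheory CategoryTheory.Limits AlgebraicGeometry MonoidalCategory Opposite TopologicalSpace
open Literature.AlgebraicGeometry.Limits Literature.AlgebraicGeometry.Morphisms
open Literature.AlgebraicGeometry.Resolution
open Literature.AlgebraicGeometry.Motives (SchemeOver specOver)

-- As in `Literature/AlgebraicGeometry/Limits/SubalgebraDiagram.lean` and `ClosedSubschemes.lean`: the
-- cone legs `c.π.app i` have source `((Functor.const _).obj c.pt).obj i`, definitionally `c.pt`.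
set_option backward.isDefEq.respectTransparency false

universe u

/-- **Base change of a resolution along a flat morphism which is surjective on stalks**
(e.g. `Spec (Frac R) → Spec R`): if `X → T` has Noetherian source admitting a resolution
`π : Y → X` with `Y` Noetherian, and `s : S → T` is flat and surjective on stalks, then `X ×_T S`
admits the resolution `Y ×_T S → X ×_T S`: proper by base change, birational by flat base change
(`isBirational_of_isPullback_of_flat`), with regular source since the local rings of `Y ×_T S` are
local rings of `Y` (`isRegular_of_flat_of_surjectiveOnStalks`). [folklore] -/
theorem hasResolution_pullback_of_flat_of_surjectiveOnStalks {X T S Y : Scheme.{u}} (f : X ⟶ T)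
    (s : S ⟶ T) [Flat s] [SurjectiveOnStalks s] (π : Y ⟶ X) (hπ : IsResolution π)
    [NoetherianSpace X] [NoetherianSpace Y] : Scheme.HasResolution (pullback f s) := by
  haveI := hπ.isProper
  obtain ⟨π', h₁, h₂⟩ :
      ∃ π' : pullback (π ≫ f) s ⟶ pullback f s,
        pullback.fst (π ≫ f) s ≫ π = π' ≫ pullback.fst f s ∧
        π' ≫ pullback.snd f s = pullback.snd (π ≫ f) s :=
    ⟨pullback.lift (pullback.fst _ _ ≫ π) (pullback.snd _ _)
      (by rw [Category.assoc, pullback.condition]),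
      (pullback.lift_fst _ _ _).symm, pullback.lift_snd _ _ _⟩
  have big := IsPullback.of_hasPullback (π ≫ f) s
  rw [← h₂] at big
  have sq : IsPullback (pullback.fst (π ≫ f) s) π' π (pullback.fst f s) :=
    IsPullback.of_bot big h₁ (IsPullback.of_hasPullback f s)
  haveI : IsProper π' := MorphismProperty.of_isPullback sq ‹IsProper π›
  haveI : SurjectiveOnStalks (pullback.fst (π ≫ f) s) :=
    MorphismProperty.pullback_fst _ _ ‹SurjectiveOnStalks s›
  exact ⟨_, π', ‹_›, isBirational_of_isPullback_of_flat sq hπ.isBirational,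
    isRegular_of_flat_of_surjectiveOnStalks (pullback.fst (π ≫ f) s) hπ.isRegular⟩

/-- STUB `stub_levelResolution` (resolution over perfect fields ⇒ resolution over finitely
generated fields): if every reduced separated scheme of finite type over a perfect field of
characteristic `p` admits a resolution, then so does every reduced separated scheme of finite
type over a finitely generated subfield `L = closure t` of a field `k` of characteristic `p`
(spread `Z` out to a model over a finitely generated `𝔽_p`-algebra `R` with `Frac R = L`, resolve
the model over the perfect field `𝔽_p`, and pass to the generic fibre). [folklore] -/
theorem stub_levelResolution : ∀ (p : ℕ) [Fact p.Prime], (∀ (κ : Type) [Field κ] [CharP κ p] [PerfectField κ] (Z : Scheme.{0}) (h : Z ⟶ Spec (.of κ)), IsSeparated h → LocallyOfFiniteType h → QuasiCompact h → IsReduced Z → Scheme.HasResolution Z) → ∀ (k : Type) [Field k] [CharP k p] (L : Subfield k) (t : Finset k), L = Subfield.closure (↑t : Set k) → ∀ (Z : Scheme.{0}) (g : Z ⟶ Spec (.of L)), IsSeparated g → LocallyOfFiniteType g → QuasiCompact g → IsReduced Z → Scheme.HasResolution Z := by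
  intro p _ H k _ _ L t hL Z g hsep hlft hqc hred
  classical
  -- ### Step 1: a closed `L`-immersion into a finite type model over a finitely generated subring
  obtain ⟨A₀, _, φ, Y₀, p₀, j, hNoeth, hfgA, -, hpsep, hplft, hpqc, hj, hjg⟩ :=
    exists_finiteTypeModel g
  letI : Algebra A₀ L := φ.toAlgebra
  haveI := hNoeth
  let P : SchemeOver A₀ := Over.mk p₀
  haveI : IsSeparated P.hom := hpsep
  haveI : QuasiCompact P.hom := hpqc
  haveI : LocallyOfFiniteType P.hom := hplft
  let jY : Z ⟶ (P ⊗ specOver A₀ L).left := j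
  haveI : IsClosedImmersion jY := hj
  have hg : jY ≫ pullback.snd P.hom (specOver A₀ L).hom = g := hjg
  -- the finite generating set `t`, seen inside `L`
  let tL : Finset L := t.subtype (· ∈ L)
  -- ### Step 2: the closed subscheme `Z` descends to a stage `R = A₀[t'] ⊆ L`, `t ⊆ t'`
  haveI : IsLocallyNoetherian (SubalgApprox.prodCone A₀ L tL P).pt := by
    haveI : IsLocallyNoetherian (specOver A₀ L).left :=
      inferInstanceAs (IsLocallyNoetherian (Spec (.of L)))
    change IsLocallyNoetherian (pullback P.hom (specOver A₀ L).hom)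
    exact LocallyOfFiniteType.isLocallyNoetherian (pullback.snd P.hom (specOver A₀ L).hom)
  obtain ⟨i, hi⟩ := exists_isPullback_toImage_of_isLocallyNoetherian
    (SubalgApprox.prodDiagram A₀ L tL P) (SubalgApprox.prodCone A₀ L tL P)
    (SubalgApprox.isLimitProdCone A₀ L tL P) jY
  have HX := hi i (𝟙 i)
  let R : Subalgebra A₀ L := SubalgApprox.sub A₀ L i.unop.1
  let π : (P ⊗ specOver A₀ L).left ⟶ (SubalgApprox.prodDiagram A₀ L tL P).obj i :=
    (SubalgApprox.prodCone A₀ L tL P).π.app i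
  have Hleg : IsPullback π (pullback.snd P.hom (specOver A₀ L).hom)
      (pullback.snd P.hom (specOver A₀ R).hom)
      (Spec.map (CommRingCat.ofHom (algebraMap R L))) :=
    SubalgApprox.isPullback_whiskerLeft_left P ((SubalgApprox.baseCone A₀ L tL).π.app i)
  let Xt : Scheme.{0} := (jY ≫ π).image
  let πt : Z ⟶ Xt := (jY ≫ π).toImage
  let ft : Xt ⟶ Spec (.of R) := (jY ≫ π).imageι ≫ pullback.snd P.hom (specOver A₀ R).hom
  let s : Spec (.of L) ⟶ Spec (.of R) := Spec.map (CommRingCat.ofHom (algebraMap R L))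
  have Hmain : IsPullback πt g ft s := by
    have h := HX.flip.paste_vert Hleg
    rwa [hg] at h
  -- `Z_R = Xt` is reduced, and separated of finite type over `R`
  haveI : IsReduced Xt := ChowLemmaProof.isReduced_image (jY ≫ π)
  haveI : IsSeparated ft := inferInstance
  haveI : LocallyOfFiniteType ft := inferInstance
  haveI : QuasiCompact ft := inferInstance
  -- ### Step 3: `R` is of finite type over the perfect field `𝔽_p`; resolve `Z_R`
  have hinj : Function.Injective (algebraMap R L) := fun x y hxy => Subtype.ext hxy
  haveI : CharP R p := (algebraMap R L).charP hinj p
  let ψ : ZMod p →+* R := ZMod.castHom (dvd_refl p) R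
  have hψ : ψ.FiniteType := by
    have h1 : Algebra.FiniteType ℤ R := hfgA.trans inferInstance
    have h2 : (algebraMap ℤ R).FiniteType := RingHom.finiteType_algebraMap.mpr h1
    have h3 : algebraMap ℤ R = ψ.comp (Int.castRingHom (ZMod p)) := RingHom.ext_int _ _
    rw [h3] at h2
    exact RingHom.FiniteType.of_comp_finiteType h2
  let b : Spec (.of R) ⟶ Spec (.of (ZMod p)) := Spec.map (CommRingCat.ofHom ψ)
  haveI : LocallyOfFiniteType b := by
    rw [HasRingHomProperty.Spec_iff (P := @LocallyOfFiniteType)]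
    exact hψ
  haveI : IsSeparated (ft ≫ b) := inferInstance
  haveI : LocallyOfFiniteType (ft ≫ b) := inferInstance
  haveI : QuasiCompact (ft ≫ b) := inferInstance
  obtain ⟨Y, πr, hres⟩ := H (ZMod p) Xt (ft ≫ b) inferInstance inferInstance inferInstance
    inferInstance
  -- ### Step 4: `L = Frac R`, so `Spec L → Spec R` is a flat preimmersion
  have htR : ∀ x ∈ t, ∃ hx : x ∈ L, (⟨x, hx⟩ : L) ∈ R := fun x hx => by
    have hxL : x ∈ L := by
      rw [hL]
      exact Subfield.subset_closure (Finset.mem_coe.2 hx)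
    exact ⟨hxL, Algebra.subset_adjoin (Finset.mem_coe.2 (i.unop.2 (Finset.mem_subtype.2 hx)))⟩
  have hsurj : ∀ z : L, ∃ x y : R, z = algebraMap R L x / algebraMap R L y := by
    intro z
    have hz : (z : k) ∈ Subfield.closure (↑t : Set k) := by
      rw [← hL]
      exact z.2
    obtain ⟨y, hy, w, hw, hyw⟩ := Subfield.mem_closure_iff.mp hz
    have hle : Subring.closure (↑t : Set k) ≤ R.toSubring.map L.subtype :=
      Subring.closure_le.mpr fun x hx => by
        obtain ⟨hxL, hxR⟩ := htR x (Finset.mem_coe.1 hx)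
        exact ⟨⟨x, hxL⟩, hxR, rfl⟩
    obtain ⟨r, hr, rfl⟩ := hle hy
    obtain ⟨r', hr', rfl⟩ := hle hw
    refine ⟨⟨r, hr⟩, ⟨r', hr'⟩, Subtype.ext ?_⟩
    change (z : k) = (((r / r' : L)) : k)
    rw [Subfield.coe_div]
    exact hyw.symm
  haveI : FaithfulSMul R L := (faithfulSMul_iff_algebraMap_injective R L).mpr hinj
  haveI : IsFractionRing R L := IsFractionRing.of_field R L hsurj
  haveI : IsPreimmersion s := IsPreimmersion.of_isLocalization (nonZeroDivisors R)
  haveI : Flat s := by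
    rw [Flat.SpecMap_iff, CommRingCat.hom_ofHom]
    exact RingHom.flat_algebraMap_iff.mpr (IsLocalization.flat L (nonZeroDivisors R))
  -- ### Step 5: the generic fibre of the resolution of `Z_R` resolves `Z ≅ Z_R ×_R Spec L`
  haveI := hres.isProper
  haveI : IsNoetherian Xt := Scheme.isNoetherian_of_finiteType_over_field (ft ≫ b)
  haveI : IsNoetherian Y := Scheme.isNoetherian_of_finiteType_over_field (πr ≫ ft ≫ b)
  exact (hasResolution_pullback_of_flat_of_surjectiveOnStalks ft s πr hres).of_iso
    Hmain.isoPullback.inv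

end Summit.ResolutionOfSingularities.ResolutionOfSingularities.Theorems

end
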